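import Summits.BirchSwinnertonDyer.Rank1Residual.AdditivePotMult.PotMultKatoFirstUnitIndex
import Summits.BirchSwinnertonDyer.Rank1Residual.AdditivePotMult.PotMultRankOneWuthrichCertificate
import HarnessLib

/-!
# X3♯(M) (REDUCIBLE `E[p]`, potentially multiplicative), EVERY odd `p` (`p = 3` included):
# Wuthrich's Thm. 16 divisibility on the `ω^{(p−1)/2}`-branch of the MULTIPLICATIVE twist `E♭` + the
# census record "first `p`-adic unit coefficient at index `n₀`" ⟹ `μ(X(E/ℚ_∞)) = 0 ∧ λ ≤ n₀`, and
# the MAIN CONJECTURE at the pair from n1011-p10's budget input or on MINIMAL rows — the X3♯(M)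
# twin of n1011-p07's `PotMultKatoFirstUnitIndex.lean` (cell `b2b-bsdres`, team n1011, seat p12
# (gen 2); offered by p07 GEN 3, INBOX 2026-08-21T07:29Z: "X3♯(M) Thm-16 twin of FILE 1")

HONEST FRAMING (cell `b2b-bsdres`, run/shared/lean/b2b/bsd-rank1-residual/, verbatim in every
file): the goal of the cell is to DELETE the COMBINATION-SHAPED residual classes of the
Birch–Swinnerton-Dyer formula for ALL analytic-rank `≤ 1` elliptic curves over `ℚ` — "full BSD
formula for every rank `≤ 1` curve in class `C`" assembled STRICTLY from published theorems — so
that the rank-`≤ 1` remainder becomes exactly the CONSTRUCTION-SHAPED classes, which are TYPED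
(missing-input `Prop`s), NOT attempted. This is not "finishing BSD". Team n1011 (RESIDUAL-MAP §I
N10 LOWER half and O7 on the X3♯(M) rows = X3 ∧ pot-mult(p), every odd `p`): research route on
CONSTRUCTION-SHAPED items; labels and marks UNCHANGED; nothing booked; NO Literature fact minted;
NO definition (currencies of record: census-ctyper1's `CensusQ6.Mult[Odd]FirstUnitIndexAt`, p01's
`CharLamLeAt`, p10's `BudgetLeLambdaAt`). Named facts enter as HYPOTHESES only: `hW16` = Wuthrich
2014 Thm. 16, the half-eigenspace divisibility for a semistable curve with REDUCIBLE `E[p]`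
(`Wuthrich2014.thm16_halfEigenCharIdeal_dvd_cyclotomicPrime`); `hmodD` = modular parametrisation
data. A census record is CERTIFICATE-EVIDENCE (two engines), never a fact; the budget input is a
typed per-curve input discharged outside the kernel. Debt 0.

## What and why

p07's FILE 1 reads Kato's full-series identity `ι g = C(u·ϖ)·B` on X4(M) ∧ surj(p) at the census
index `n₀`. On X3♯(M) the image hypothesis is EMPTY: `E[p]` is reducible (part of `ClassX3M`), so is
`E♭[p]` (`irr_iff_of_model_twist`), and the divisibility is Wuthrich's Thm. 16 instead of Kato
17.4 (3) — this seat's brick `isTorsion_and_exists_iota_eq_of_wuthrichHalf` (T-O7KM-X3). Everything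
downstream is p07's / p10's / iw-1's algebra BY NAME (`hasUnitContent_and_lam_le_of_iota_eq_of_norm_coeff_eq_one`,
`unitContent_and_mu_eq_zero_and_lam_le_of_mem_span`, `budgetSqueeze`, `Iwasawa.minimal_package`).

* §1 (data level, ANY twist datum with `V[p]` reducible, index `n`; NO tower, NO image)
  `isTorsion_and_exists_iota_eq_unitContent_of_wuthrichHalf`; with the budget
  `charIdeal_eq_span_of_wuthrichHalf_of_norm_coeff_of_budget` (the MAIN CONJECTURE at the pair,
  analytic generator `u·ϖ·B`); at `n = rank E(ℚ)` `minimalPackage_of_wuthrichHalf_of_norm_coeff_mordellWeilRank`.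
* §2 (class level X3♯(M), both parities, EVERY odd `p`) from the census record:
  `ClassX3M.isTorsion_and_exists_unitContent_lam_le_of_wuthrichHalf_of_firstUnitIndex[_odd]`,
  `ClassX3M.mu_zero_and_lam_le_of_wuthrichHalf_of_firstUnitIndex[_odd]`,
  `ClassX3M.charLamLeAt_of_wuthrichHalf_of_firstUnitIndex[_odd]` (`CharLamLeAt W p n₀`; T-O7KM-X3's
  `charLamLeAt_one_…` is `n₀ = 1`).

NOT binders: `Surj`, tower, `5 ≤ p`, `¬CM`, `hna`, `hL20`, `hPal`. What is NOT claimed: the budget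
bound itself; any BSD_p consequence (the rank-0 / rank-1 ends are T-c2x3 (v) / T-O7KM-X3 files);
`p = 2`. Labels UNCHANGED; nothing booked; X3 stays CONSTRUCTION-SHAPED.

BUDGET SOURCE ON X3 ROWS (n1011-r2 GEN 7, ROUTE-2 II.13.2; doc-only scope note): n1011-p10's typed input
`BudgetLeLambdaAt p W b` is a THEOREM for `b ≤ rank E(ℚ)` (p07's `budgetLeLambdaAt_of_le_mordellWeilRank`);
for `b > rank E(ℚ)` its printed discharge (Emerton–Pollack–Weston 2006 Cor. 3.2.5 + Thm. 3.1.1) assumes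
`ρ̄` ABSOLUTELY IRREDUCIBLE, so on X3 (reducible) rows the budget is an UNPRINTED per-pair binder —
candidate discharge Greenberg LNM 1716 Prop. 4.14 (no finite-index Λ-submodule) + Greenberg 2010
(Kyoto J. Math. 50) Prop. 3.2.1 (b) + II.10.9, to be instantiated (sub-target T-E3gX3-bud). Every EPW
citation below is the source of the typed input on IRREDUCIBLE rows only.

References: C. Wuthrich, Doc. Math. 19 (2014) Thm. 16, §3 [Wuthrich2014]; R. Greenberg, V. Vatsal,
Invent. Math. 142 (2000) p. 4 [GreenbergVatsal2000]; R. Greenberg, LNM 1716 (1999) §3 Lemma 3.1, §5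
[GreenbergLNM1716]; M. Emerton, R. Pollack, T. Weston, Invent. Math. 163 (2006) §3
[EmertonPollackWeston2006]; B. Mazur, J. Tate, J. Teitelbaum, Invent. Math. 84 (1986) §I.13
[MazurTateTeitelbaum1986Invent]; L. Washington, GTM 83 (1997) §7.1, §13.2 [Washington1997];
W. Stein, C. Wuthrich, Math. Comp. 82 (2013) §11 [SteinWuthrich2013].
-/

set_option autoImplicit false

noncomputable section

open scoped Classical MatrixGroups ModularForm NumberField

namespace Summit.BirchSwinnertonDyer.Rank1Residual.AdditivePotMult

open CongruenceSubgroup WeierstrassCurve NumberField Literature.NumberTheory.EllipticCurves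
  Literature.NumberTheory.EllipticCurves.ModularForms
  Literature.NumberTheory.EllipticCurves.Rank1Residual
  Literature.NumberTheory.EllipticCurves.Rank1Residual.Typed
  Literature.NumberTheory.EllipticCurves.GreenbergVatsal2000
  Literature.NumberTheory.GaloisRepresentations
  Summit.BirchSwinnertonDyer.Rank1Residual.Additive
  Summit.BirchSwinnertonDyer.Rank1Residual.Additive.CensusQ6
  Summit.BirchSwinnertonDyer.Rank1Residual.X1.MuLambda
  Summit.BirchSwinnertonDyer.Rank1Residual.X11a
  Summit.BirchSwinnertonDyer.Rank1Residual.X11a.LambdaNorm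
  Summit.BirchSwinnertonDyer.Rank1Residual.Iwasawa
  IsDedekindDomain

/-! ### §1 Data level (REDUCIBLE `V[p]`): the index-`n` reading of the brick, and the squeeze -/

section DataLevel

variable {W : WeierstrassCurve ℚ} [W.IsElliptic] {p : ℕ} [hp : Fact p.Prime]

/-- **Data level, EVERY odd `p`, twist datum with REDUCIBLE `V[p]`, index `n`.** For a twist model
`C • V^{(p*)} = W` with `V[p]` reducible, a cyclotomic `κ/γ` matching the cyclotomic variable, the
newform `f` of `V`, a branch series `B` in the reduction disjunction, the period ratio `ϖ` of the
parity of `(p−1)/2`, EVERY `Λ`-dual datum `D` of `Sel_{p^∞}(W/ℚ_∞)` and an index `n` with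
`‖[Tⁿ](ϖ·B)‖_p = 1`: `X(W/ℚ_∞)` is torsion and SOME `g ∈ char_Λ X(W/ℚ_∞)` has `ι g = C(u·ϖ)·B`
(`u ∈ ℤ_p^×`), unit content and `λ(g) ≤ n`. This seat's brick `isTorsion_and_exists_iota_eq_of_wuthrichHalf`
(Wuthrich Thm. 16 via `hW16`) + p10's K-G. NO image / tower hypothesis.
[cite: Wuthrich2014, Thm. 16 (p. 397)] [cite: GreenbergVatsal2000, p. 4 ((μ, λ) of a power series)]
[cite: Washington1997, §7.1] -/
theorem isTorsion_and_exists_iota_eq_unitContent_of_wuthrichHalf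
    (hW16 : Wuthrich2014.thm16_halfEigenCharIdeal_dvd_cyclotomicPrime) (hp2 : p ≠ 2)
    (V : WeierstrassCurve ℚ) [V.IsElliptic] [V.IsGloballyMinimal] (C : VariableChange ℚ)
    (hC : C • V.quadraticTwist ((-1 : ℚ) ^ (p / 2) * p) = W) (hirrV : ¬ V.HasIrreducibleModPGaloisRep p)
    {κ : ZpExtension ℚ p} {γ : Field.absoluteGaloisGroup ℚ}
    (hκ : κ.IsCyclotomic) (hγ : κ.IsTopGenerator γ) (hcv : IsCyclotomicVariable p γ)
    {N : ℕ} [NeZero N] {f : CuspForm (Gamma0 N) 2} (hf : IsNewformOf V f)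
    (D : W.SelmerDualData κ γ) (B : PowerSeries ℚ_[p])
    (hdisj : (IsOrdinaryAt V p ∧
        B = if Even (p / 2) then padicLFunctionBranch f ((unitRoot V p : ℤ_[p]) : ℚ_[p]) (p / 2)
          else padicLFunctionMinusBranch f ((unitRoot V p : ℤ_[p]) : ℚ_[p]) (p / 2)) ∨
      (V.HasSplitMultiplicativeReductionAtPrime p ∧
        B = if Even (p / 2) then padicLFunctionPlusBranchMult f (1 : ℚ_[p]) (p / 2)
          else padicLFunctionMinusBranchMult f (1 : ℚ_[p]) (p / 2)) ∨
      (V.HasMultiplicativeReductionAtPrime p ∧ ¬ V.HasSplitMultiplicativeReductionAtPrime p ∧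
        B = if Even (p / 2) then padicLFunctionPlusBranchMult f (-1 : ℚ_[p]) (p / 2)
          else padicLFunctionMinusBranchMult f (-1 : ℚ_[p]) (p / 2)))
    (ϖ : ℚ) (hϖ : if Even (p / 2) then (ϖ : ℝ) * V.realPeriodRat = plusPeriod f
      else (ϖ : ℝ) * V.imaginaryPeriodRat = minusPeriod f)
    {n : ℕ} (hn : ‖PowerSeries.coeff n (PowerSeries.C (ϖ : ℚ_[p]) * B)‖ = 1) :
    D.IsTorsion ∧ ∃ g ∈ D.charIdeal,
      (∃ u : ℤ_[p]ˣ,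
        iwasawaToPowerSeries p g = PowerSeries.C (((u : ℤ_[p]) : ℚ_[p]) * (ϖ : ℚ_[p])) * B) ∧
      HasUnitContent g ∧ lam g ≤ n := by
  obtain ⟨hXt, g, hg, u, hι⟩ :=
    isTorsion_and_exists_iota_eq_of_wuthrichHalf hW16 hp2 V C hC hirrV hκ hγ hcv hf D B hdisj ϖ hϖ
  exact ⟨hXt, g, hg, ⟨u, hι⟩, hasUnitContent_and_lam_le_of_iota_eq_of_norm_coeff_eq_one hι hn⟩

/-- **The MAIN CONJECTURE at the pair from the budget (data level, REDUCIBLE `V[p]`, EVERY odd `p`).**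
Same binders as `isTorsion_and_exists_iota_eq_unitContent_of_wuthrichHalf` at index `b`, plus p10's
typed per-curve LOWER input `BudgetLeLambdaAt p W b`: for EVERY cyclotomic dual datum `D`,
`X(W/ℚ_∞)` is torsion and `char_Λ X(W/ℚ_∞) = (g)` with `ι g = C(u·ϖ)·B`, `g` of unit content,
`μ(X) = 0`, `λ(X) = b`. Route: §1 + a generator (`charIdeal_isPrincipal_holds`) + p10's `budgetSqueeze`.
[cite: Wuthrich2014, Thm. 16 (p. 397)] [cite: EmertonPollackWeston2006, Cor. 3.2.5 and Thm. 3.1.1 (typed input's source on IRREDUCIBLE rows only; X3: see header)]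
[cite: GreenbergVatsal2000, p. 4 (after Thm. (1.2))] [cite: Washington1997, §13.2] -/
theorem charIdeal_eq_span_of_wuthrichHalf_of_norm_coeff_of_budget [W.IsGloballyMinimal]
    (hW16 : Wuthrich2014.thm16_halfEigenCharIdeal_dvd_cyclotomicPrime) (hp2 : p ≠ 2)
    {b : ℕ} (hbud : BudgetLeLambdaAt p W b)
    (V : WeierstrassCurve ℚ) [V.IsElliptic] [V.IsGloballyMinimal] (C : VariableChange ℚ)
    (hC : C • V.quadraticTwist ((-1 : ℚ) ^ (p / 2) * p) = W) (hirrV : ¬ V.HasIrreducibleModPGaloisRep p)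
    {κ : ZpExtension ℚ p} {γ : Field.absoluteGaloisGroup ℚ}
    (hκ : κ.IsCyclotomic) (hγ : κ.IsTopGenerator γ) (hcv : IsCyclotomicVariable p γ)
    {N : ℕ} [NeZero N] {f : CuspForm (Gamma0 N) 2} (hf : IsNewformOf V f)
    (D : W.SelmerDualData κ γ) (B : PowerSeries ℚ_[p])
    (hdisj : (IsOrdinaryAt V p ∧
        B = if Even (p / 2) then padicLFunctionBranch f ((unitRoot V p : ℤ_[p]) : ℚ_[p]) (p / 2)
          else padicLFunctionMinusBranch f ((unitRoot V p : ℤ_[p]) : ℚ_[p]) (p / 2)) ∨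
      (V.HasSplitMultiplicativeReductionAtPrime p ∧
        B = if Even (p / 2) then padicLFunctionPlusBranchMult f (1 : ℚ_[p]) (p / 2)
          else padicLFunctionMinusBranchMult f (1 : ℚ_[p]) (p / 2)) ∨
      (V.HasMultiplicativeReductionAtPrime p ∧ ¬ V.HasSplitMultiplicativeReductionAtPrime p ∧
        B = if Even (p / 2) then padicLFunctionPlusBranchMult f (-1 : ℚ_[p]) (p / 2)
          else padicLFunctionMinusBranchMult f (-1 : ℚ_[p]) (p / 2)))
    (ϖ : ℚ) (hϖ : if Even (p / 2) then (ϖ : ℝ) * V.realPeriodRat = plusPeriod f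
      else (ϖ : ℝ) * V.imaginaryPeriodRat = minusPeriod f)
    (hn : ‖PowerSeries.coeff b (PowerSeries.C (ϖ : ℚ_[p]) * B)‖ = 1) :
    D.IsTorsion ∧ ∃ g : IwasawaAlgebra p, D.charIdeal = Ideal.span {g} ∧
      (∃ u : ℤ_[p]ˣ,
        iwasawaToPowerSeries p g = PowerSeries.C (((u : ℤ_[p]) : ℚ_[p]) * (ϖ : ℚ_[p])) * B) ∧
      HasUnitContent g ∧ D.mu = 0 ∧ lambdaInvariant p D.X = b := by
  obtain ⟨hXt, g, hg, hu, hunit, hlam⟩ := isTorsion_and_exists_iota_eq_unitContent_of_wuthrichHalf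
    hW16 hp2 V C hC hirrV hκ hγ hcv hf D B hdisj ϖ hϖ hn
  haveI : Module.Finite (IwasawaAlgebra p) D.X := D.module_finite_holds hγ
  obtain ⟨fE, hchar⟩ := (charIdeal_isPrincipal_holds p D.X).principal
  have hchar' : D.charIdeal = Ideal.span {fE} := hchar
  have hdvd : fE ∣ g := Ideal.mem_span_singleton.mp (hchar' ▸ hg)
  obtain ⟨hspan, hmu, hlamD⟩ := budgetSqueeze p W hbud hκ hγ hcv D hXt hchar' hunit hdvd hlam
  exact ⟨hXt, g, hchar'.trans hspan.symm, hu, hunit, hmu, hlamD⟩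

/-- **MINIMAL PAIRS, REDUCIBLE `V[p]`: the main conjecture at the pair with NO lower input.** Same
binders at index `n = rank W(ℚ)`: `T^{rank} ∣ fE` (`Typed.X_pow_mordellWeilRank_dvd_of_charIdeal_eq_span`)
and iw-1's `Iwasawa.minimal_package` give, for EVERY generator `fE` of `char_Λ X(W/ℚ_∞)`:
`(g) = (fE)` with `ι g = C(u·ϖ)·B`, `λ(fE) = λ(g) = rank W(ℚ)`, `μ(fE) = μ(g) = 0`,
`ord_{T=0} fE = rank W(ℚ)` and `[T^{rank}] fE ∈ ℤ_p^×`. [cite: Wuthrich2014, Thm. 16 (p. 397)]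
[cite: GreenbergLNM1716, §3 Lemma 3.1 (T^{rank} ∣ char)] [cite: SteinWuthrich2013, §11 remark (p. 29)]
[cite: GreenbergVatsal2000, p. 4 (after Thm. (1.2))] -/
theorem minimalPackage_of_wuthrichHalf_of_norm_coeff_mordellWeilRank
    (hW16 : Wuthrich2014.thm16_halfEigenCharIdeal_dvd_cyclotomicPrime) (hp2 : p ≠ 2)
    (V : WeierstrassCurve ℚ) [V.IsElliptic] [V.IsGloballyMinimal] (C : VariableChange ℚ)
    (hC : C • V.quadraticTwist ((-1 : ℚ) ^ (p / 2) * p) = W) (hirrV : ¬ V.HasIrreducibleModPGaloisRep p)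
    {κ : ZpExtension ℚ p} {γ : Field.absoluteGaloisGroup ℚ}
    (hκ : κ.IsCyclotomic) (hγ : κ.IsTopGenerator γ) (hcv : IsCyclotomicVariable p γ)
    {N : ℕ} [NeZero N] {f : CuspForm (Gamma0 N) 2} (hf : IsNewformOf V f)
    (D : W.SelmerDualData κ γ) (B : PowerSeries ℚ_[p])
    (hdisj : (IsOrdinaryAt V p ∧
        B = if Even (p / 2) then padicLFunctionBranch f ((unitRoot V p : ℤ_[p]) : ℚ_[p]) (p / 2)
          else padicLFunctionMinusBranch f ((unitRoot V p : ℤ_[p]) : ℚ_[p]) (p / 2)) ∨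
      (V.HasSplitMultiplicativeReductionAtPrime p ∧
        B = if Even (p / 2) then padicLFunctionPlusBranchMult f (1 : ℚ_[p]) (p / 2)
          else padicLFunctionMinusBranchMult f (1 : ℚ_[p]) (p / 2)) ∨
      (V.HasMultiplicativeReductionAtPrime p ∧ ¬ V.HasSplitMultiplicativeReductionAtPrime p ∧
        B = if Even (p / 2) then padicLFunctionPlusBranchMult f (-1 : ℚ_[p]) (p / 2)
          else padicLFunctionMinusBranchMult f (-1 : ℚ_[p]) (p / 2)))
    (ϖ : ℚ) (hϖ : if Even (p / 2) then (ϖ : ℝ) * V.realPeriodRat = plusPeriod f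
      else (ϖ : ℝ) * V.imaginaryPeriodRat = minusPeriod f)
    (hn : ‖PowerSeries.coeff W.mordellWeilRank (PowerSeries.C (ϖ : ℚ_[p]) * B)‖ = 1)
    {fE : IwasawaAlgebra p} (hchar : D.charIdeal = Ideal.span {fE}) :
    D.IsTorsion ∧ ∃ g : IwasawaAlgebra p,
      (∃ u : ℤ_[p]ˣ,
        iwasawaToPowerSeries p g = PowerSeries.C (((u : ℤ_[p]) : ℚ_[p]) * (ϖ : ℚ_[p])) * B) ∧
      Ideal.span ({g} : Set (IwasawaAlgebra p)) = Ideal.span {fE} ∧ lam fE = W.mordellWeilRank ∧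
      lam g = W.mordellWeilRank ∧ mu fE = 0 ∧ mu g = 0 ∧ fE.order = W.mordellWeilRank ∧
      IsUnit (PowerSeries.coeff W.mordellWeilRank fE) := by
  obtain ⟨hXt, g, hg, hu, hunit, hlam⟩ := isTorsion_and_exists_iota_eq_unitContent_of_wuthrichHalf
    hW16 hp2 V C hC hirrV hκ hγ hcv hf D B hdisj ϖ hϖ hn
  haveI : Module.Finite (IwasawaAlgebra p) D.X := D.module_finite_holds hγ
  have hdvd : fE ∣ g := Ideal.mem_span_singleton.mp (hchar ▸ hg)
  have hXr : (PowerSeries.X : IwasawaAlgebra p) ^ W.mordellWeilRank ∣ fE :=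
    X_pow_mordellWeilRank_dvd_of_charIdeal_eq_span W p hγ D hXt hchar
  exact ⟨hXt, g, hu, minimal_package hunit hdvd hXr hlam⟩

end DataLevel

/-! ### §2 Class level on X3♯(M): the census record discharges `μ = 0 ∧ λ ≤ n₀` (NO image input) -/

section ClassLevel

variable {W : WeierstrassCurve ℚ} [W.IsElliptic] [W.IsGloballyMinimal] {p : ℕ} [hp : Fact p.Prime]

/-- **X3♯(M), `p ≡ 1 (mod 4)` (even branch): Wuthrich's divisibility + the census record
`MultFirstUnitIndexAt W p n₀` ⟹ for EVERY cyclotomic dual datum: `X(E/ℚ_∞)` is torsion and SOME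
`g ∈ char_Λ X(E/ℚ_∞)` has unit content and `λ(g) ≤ n₀`.** p07's X4(M) proof with the tower line
replaced by reducibility (`E[p]` reducible is part of `ClassX3M`; `E♭[p]` by `irr_iff_of_model_twist`):
twist model `ClassX3M.exists_mult_pStar_twist_model`, parametrisation datum, period ratio,
`a_p(E♭) = ±1` by the split / non-split dichotomy, §1. Only the UNIT clause of the record is used.
[cite: Wuthrich2014, Thm. 16 (p. 397)] [cite: MazurTateTeitelbaum1986Invent, §I.13 (the branch series)] -/
theorem ClassX3M.isTorsion_and_exists_unitContent_lam_le_of_wuthrichHalf_of_firstUnitIndex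
    (hW16 : Wuthrich2014.thm16_halfEigenCharIdeal_dvd_cyclotomicPrime)
    (hmodD : nonempty_modularParametrizationData)
    (hX : ClassX3M W p) (hp4 : p % 4 = 1) {n₀ : ℕ} (hrec : MultFirstUnitIndexAt W p n₀)
    {κ : ZpExtension ℚ p} {γ : Field.absoluteGaloisGroup ℚ}
    (hκ : κ.IsCyclotomic) (hγ : κ.IsTopGenerator γ) (hγ' : IsCyclotomicVariable p γ)
    (D : W.SelmerDualData κ γ) :
    D.IsTorsion ∧ ∃ g ∈ D.charIdeal, HasUnitContent g ∧ lam g ≤ n₀ := by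
  have hp2 : p ≠ 2 := hX.p_ne_two
  obtain ⟨V, iV, iVm, C, hV, hC⟩ := hX.exists_mult_pStar_twist_model
  haveI : NeZero (V.conductorNorm ℤ) := ⟨(V.conductorNorm_pos_holds).ne'⟩
  obtain ⟨Dm⟩ := hmodD V
  obtain ⟨ϖ, hϖ⟩ := exists_periodRatio_parity (p := p) V Dm
  have hirrV : ¬ V.HasIrreducibleModPGaloisRep p := fun hVirr ↦
    hX.classX3.1 ((irr_iff_of_model_twist (W := V) (p := p) (pStar_ne_zero p) ⟨C, hC⟩).mpr hVirr)
  have heven : Even (p / 2) := ⟨p / 4, by omega⟩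
  have hC' : C • V.quadraticTwist (p : ℚ) = W := by
    rw [← pStar_eq_self_of_mod_four_eq_one hp4]; exact hC
  have hϖ' : (ϖ : ℝ) * V.realPeriodRat = plusPeriod Dm.f := by
    rw [if_pos heven] at hϖ; exact hϖ
  by_cases hs : V.HasSplitMultiplicativeReductionAtPrime p
  · obtain ⟨hap, -⟩ := Dm.isNewformOf.cuspCoeff_eq_one_and_sq_of_split hs
    have hn := (hrec V C hV hC' Dm.f Dm.isNewformOf 1 (by exact_mod_cast hap) ϖ hϖ').2
    rw [Int.cast_one] at hn
    obtain ⟨hXt, g, hg, -, hunit, hlam⟩ := isTorsion_and_exists_iota_eq_unitContent_of_wuthrichHalf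
      hW16 hp2 V C hC hirrV hκ hγ hγ' Dm.isNewformOf D _ (Or.inr (Or.inl ⟨hs, rfl⟩)) ϖ hϖ
      (n := n₀) (by rw [if_pos heven]; exact hn)
    exact ⟨hXt, g, hg, hunit, hlam⟩
  · obtain ⟨hap, -⟩ := Dm.isNewformOf.cuspCoeff_eq_neg_one_and_dvd_of_nonsplit hV hs
    have hn := (hrec V C hV hC' Dm.f Dm.isNewformOf (-1) (by exact_mod_cast hap) ϖ hϖ').2
    rw [Int.cast_neg, Int.cast_one] at hn
    obtain ⟨hXt, g, hg, -, hunit, hlam⟩ := isTorsion_and_exists_iota_eq_unitContent_of_wuthrichHalf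
      hW16 hp2 V C hC hirrV hκ hγ hγ' Dm.isNewformOf D _ (Or.inr (Or.inr ⟨hV, hs, rfl⟩)) ϖ hϖ
      (n := n₀) (by rw [if_pos heven]; exact hn)
    exact ⟨hXt, g, hg, hunit, hlam⟩

/-- **X3♯(M), `p ≡ 3 (mod 4)` (`p = 3` included; odd branch, twist by `−p`, minus period):
Wuthrich's divisibility + the record `MultOddFirstUnitIndexAt W p n₀` ⟹ for EVERY cyclotomic dual
datum: `X(E/ℚ_∞)` is torsion and SOME `g ∈ char_Λ X(E/ℚ_∞)` has unit content and `λ(g) ≤ n₀`.**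
[cite: Wuthrich2014, Thm. 16 (p. 397)] [cite: MazurTateTeitelbaum1986Invent, §I.13 (the branch series)] -/
theorem ClassX3M.isTorsion_and_exists_unitContent_lam_le_of_wuthrichHalf_of_firstUnitIndex_odd
    (hW16 : Wuthrich2014.thm16_halfEigenCharIdeal_dvd_cyclotomicPrime)
    (hmodD : nonempty_modularParametrizationData)
    (hX : ClassX3M W p) (hp4 : p % 4 = 3) {n₀ : ℕ} (hrec : MultOddFirstUnitIndexAt W p n₀)
    {κ : ZpExtension ℚ p} {γ : Field.absoluteGaloisGroup ℚ}
    (hκ : κ.IsCyclotomic) (hγ : κ.IsTopGenerator γ) (hγ' : IsCyclotomicVariable p γ)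
    (D : W.SelmerDualData κ γ) :
    D.IsTorsion ∧ ∃ g ∈ D.charIdeal, HasUnitContent g ∧ lam g ≤ n₀ := by
  have hp2 : p ≠ 2 := hX.p_ne_two
  obtain ⟨V, iV, iVm, C, hV, hC⟩ := hX.exists_mult_pStar_twist_model
  haveI : NeZero (V.conductorNorm ℤ) := ⟨(V.conductorNorm_pos_holds).ne'⟩
  obtain ⟨Dm⟩ := hmodD V
  obtain ⟨ϖ, hϖ⟩ := exists_periodRatio_parity (p := p) V Dm
  have hirrV : ¬ V.HasIrreducibleModPGaloisRep p := fun hVirr ↦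
    hX.classX3.1 ((irr_iff_of_model_twist (W := V) (p := p) (pStar_ne_zero p) ⟨C, hC⟩).mpr hVirr)
  have hodd : ¬ Even (p / 2) := by rw [Nat.not_even_iff_odd]; exact ⟨p / 4, by omega⟩
  have hC' : C • V.quadraticTwist (-(p : ℚ)) = W := by
    rw [← pStar_eq_neg_of_mod_four_eq_three hp4]; exact hC
  have hϖ' : (ϖ : ℝ) * V.imaginaryPeriodRat = minusPeriod Dm.f := by
    rw [if_neg hodd] at hϖ; exact hϖ
  by_cases hs : V.HasSplitMultiplicativeReductionAtPrime p
  · obtain ⟨hap, -⟩ := Dm.isNewformOf.cuspCoeff_eq_one_and_sq_of_split hs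
    have hn := (hrec V C hV hC' Dm.f Dm.isNewformOf 1 (by exact_mod_cast hap) ϖ hϖ').2
    rw [Int.cast_one] at hn
    obtain ⟨hXt, g, hg, -, hunit, hlam⟩ := isTorsion_and_exists_iota_eq_unitContent_of_wuthrichHalf
      hW16 hp2 V C hC hirrV hκ hγ hγ' Dm.isNewformOf D _ (Or.inr (Or.inl ⟨hs, rfl⟩)) ϖ hϖ
      (n := n₀) (by rw [if_neg hodd]; exact hn)
    exact ⟨hXt, g, hg, hunit, hlam⟩
  · obtain ⟨hap, -⟩ := Dm.isNewformOf.cuspCoeff_eq_neg_one_and_dvd_of_nonsplit hV hs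
    have hn := (hrec V C hV hC' Dm.f Dm.isNewformOf (-1) (by exact_mod_cast hap) ϖ hϖ').2
    rw [Int.cast_neg, Int.cast_one] at hn
    obtain ⟨hXt, g, hg, -, hunit, hlam⟩ := isTorsion_and_exists_iota_eq_unitContent_of_wuthrichHalf
      hW16 hp2 V C hC hirrV hκ hγ hγ' Dm.isNewformOf D _ (Or.inr (Or.inr ⟨hV, hs, rfl⟩)) ϖ hϖ
      (n := n₀) (by rw [if_neg hodd]; exact hn)
    exact ⟨hXt, g, hg, hunit, hlam⟩

/-- **Generator form, X3♯(M), `p ≡ 1 (mod 4)`: for EVERY generator `fE` of `char_Λ X(E/ℚ_∞)`, `X` is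
torsion, `fE` has unit content, `μ(fE) = 0` and `λ(fE) ≤ n₀`** — the index-`n₀` generalisation of
T-O7KM-X3's `ClassX3M.isTorsion_and_mu_zero_lam_le_one_of_wuthrichHalf_of_multCert`.
[cite: Wuthrich2014, Thm. 16 (p. 397)] [cite: Washington1997, §7.1] -/
theorem ClassX3M.mu_zero_and_lam_le_of_wuthrichHalf_of_firstUnitIndex
    (hW16 : Wuthrich2014.thm16_halfEigenCharIdeal_dvd_cyclotomicPrime)
    (hmodD : nonempty_modularParametrizationData)
    (hX : ClassX3M W p) (hp4 : p % 4 = 1) {n₀ : ℕ} (hrec : MultFirstUnitIndexAt W p n₀)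
    {κ : ZpExtension ℚ p} {γ : Field.absoluteGaloisGroup ℚ}
    (hκ : κ.IsCyclotomic) (hγ : κ.IsTopGenerator γ) (hγ' : IsCyclotomicVariable p γ)
    (D : W.SelmerDualData κ γ) {fE : IwasawaAlgebra p} (hchar : D.charIdeal = Ideal.span {fE}) :
    D.IsTorsion ∧ HasUnitContent fE ∧ mu fE = 0 ∧ lam fE ≤ n₀ := by
  obtain ⟨hXt, g, hg, hunit, hlam⟩ :=
    hX.isTorsion_and_exists_unitContent_lam_le_of_wuthrichHalf_of_firstUnitIndex hW16 hmodD hp4 hrec hκ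
      hγ hγ' D
  exact ⟨hXt, unitContent_and_mu_eq_zero_and_lam_le_of_mem_span (hchar ▸ hg) hunit hlam⟩

/-- **Generator form, X3♯(M), `p ≡ 3 (mod 4)` (`p = 3` included).**
[cite: Wuthrich2014, Thm. 16 (p. 397)] [cite: Washington1997, §7.1] -/
theorem ClassX3M.mu_zero_and_lam_le_of_wuthrichHalf_of_firstUnitIndex_odd
    (hW16 : Wuthrich2014.thm16_halfEigenCharIdeal_dvd_cyclotomicPrime)
    (hmodD : nonempty_modularParametrizationData)
    (hX : ClassX3M W p) (hp4 : p % 4 = 3) {n₀ : ℕ} (hrec : MultOddFirstUnitIndexAt W p n₀)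
    {κ : ZpExtension ℚ p} {γ : Field.absoluteGaloisGroup ℚ}
    (hκ : κ.IsCyclotomic) (hγ : κ.IsTopGenerator γ) (hγ' : IsCyclotomicVariable p γ)
    (D : W.SelmerDualData κ γ) {fE : IwasawaAlgebra p} (hchar : D.charIdeal = Ideal.span {fE}) :
    D.IsTorsion ∧ HasUnitContent fE ∧ mu fE = 0 ∧ lam fE ≤ n₀ := by
  obtain ⟨hXt, g, hg, hunit, hlam⟩ :=
    hX.isTorsion_and_exists_unitContent_lam_le_of_wuthrichHalf_of_firstUnitIndex_odd hW16 hmodD hp4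
      hrec hκ hγ hγ' D
  exact ⟨hXt, unitContent_and_mu_eq_zero_and_lam_le_of_mem_span (hchar ▸ hg) hunit hlam⟩

/-- **p01's typed λ-input `CharLamLeAt W p n₀` HOLDS on X3♯(M), `p ≡ 1 (mod 4)`, given the record**
(T-O7KM-X3's `charLamLeAt_one_…` is `n₀ = 1`). [cite: Wuthrich2014, Thm. 16 (p. 397)] -/
theorem ClassX3M.charLamLeAt_of_wuthrichHalf_of_firstUnitIndex
    (hW16 : Wuthrich2014.thm16_halfEigenCharIdeal_dvd_cyclotomicPrime)
    (hmodD : nonempty_modularParametrizationData)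
    (hX : ClassX3M W p) (hp4 : p % 4 = 1) {n₀ : ℕ} (hrec : MultFirstUnitIndexAt W p n₀) :
    CharLamLeAt W p n₀ :=
  fun _ _ hκ hγ hγ' D _ hchar ↦
    (hX.mu_zero_and_lam_le_of_wuthrichHalf_of_firstUnitIndex hW16 hmodD hp4 hrec hκ hγ hγ' D
      hchar).2.2.2

/-- **`CharLamLeAt W p n₀` on X3♯(M), `p ≡ 3 (mod 4)` (`p = 3` included), given the record.**
[cite: Wuthrich2014, Thm. 16 (p. 397)] -/
theorem ClassX3M.charLamLeAt_of_wuthrichHalf_of_firstUnitIndex_odd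
    (hW16 : Wuthrich2014.thm16_halfEigenCharIdeal_dvd_cyclotomicPrime)
    (hmodD : nonempty_modularParametrizationData)
    (hX : ClassX3M W p) (hp4 : p % 4 = 3) {n₀ : ℕ} (hrec : MultOddFirstUnitIndexAt W p n₀) :
    CharLamLeAt W p n₀ :=
  fun _ _ hκ hγ hγ' D _ hchar ↦
    (hX.mu_zero_and_lam_le_of_wuthrichHalf_of_firstUnitIndex_odd hW16 hmodD hp4 hrec hκ hγ hγ' D
      hchar).2.2.2

end ClassLevel

end Summit.BirchSwinnertonDyer.Rank1Residual.AdditivePotMult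

end
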